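import Mathlib
import HarnessLib
import HarnessLib.Audit
import Summits.ResolutionOfSingularities.Statement
import Literature.AlgebraicGeometry.Resolution.ComponentGluing
import HarnessLib.Audit.Status.Attr

/-!
Route: SharpStrata

# Route SharpStrata — blow up where Kolchin fails — separably-exceptional models (BPR Question 6.6)
first, then resolve what is left

OPEN-QUESTION HARVEST (operator A; printed question: Benito–Piltant–Reguera, JPAA 226 (2022) 107110,
§6 Question 6.6 "can small irreducible
components [of the arc space] be eliminated by blowing up?", answered there only birationally and
only for p > (dim X)! (Prop. 6.7, Albanese)).
It suffices to show, for every prime p and over PERFECT ground fields, X = SepExcModels ∧ ResSepExc,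
plus the shared descent DescentPerfectToAll
(stmt-0549). Call an integral Y SEPARABLY EXCEPTIONAL (SepExc) if every NON-CLOSED, NON-REGULAR
point ζ of Y carries a prime divisor with
separably generated residue field over κ(ζ): typed without arc schemes as "some finitely generated
birational local model B = O_{Y,ζ}[s] ⊆ K(Y)
has a prime 𝔮 over m_ζ with B_𝔮 regular and B/𝔮 generically smooth over κ(ζ)" — exactly the
hypothesis of BPR Prop. 4.3 / Thm. 4.4, which
makes Y arc-BLUNT at ζ (no small arc component with generic point the generic arc of Reg(closure
ζ)); a SepExc variety is a Kolchin model in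
BPR's sense (their Thm. 4.4; the converse is their Question 6.2). SepExcModels (crux, rank 2): every
integral X over a perfect field of
characteristic p admits a proper birational X' → X with X' integral and SepExc — Question 6.6 in
valuative dress, to be reached by the
KOLCHIN PHASE of card blunt-or-sharp-kolchin-models: blow up the (reduced) closures of the maximal
sharp points, normalise, repeat.
ResSepExc (crux, rank 3): SepExc varieties are resolvable. Card realised:
blunt-or-sharp-kolchin-models (spine; its K1 = SepExcModels via
BPR Thm 4.4, its K3 = ResSepExc).
Lean: `SepExcModels ∧ ResSepExc ∧ DescentPerfectToAll`

## Assembly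
Pure logic plus two proved tree lemmas (sketch/Sketch.lean = glue.lean: lean check rc 0, 0 sorries,
`closes` axioms propext · Classical.choice ·
Quot.sound): fix p prime; `DescentPerfectToAll p hp` reduces `ResolutionInChar p` to reduced
separated finite-type X over PERFECT k;
`Literature.AlgebraicGeometry.Resolution.ComponentGluing.hasResolution_of_forall_closeds`
(Cossart–Piltant Prop 4.6 Step 1, proved) reduces
to the integral closed subschemes Z ↪ X; `SepExcModels` gives X' → Z proper birational, integral,
separably exceptional; `ResSepExc` resolves X'
(its structure map X' → Z → X → Spec k is separated, of finite type — instances from properness);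
`ComponentGluing.Scheme.HasResolution.of_isBirational`
transports the resolution down to Z; `ResolutionOfSingularities_iff` gives the summit.

Rationale: WHY THIS LINE. Kolchin's irreducibility theorem for arc spaces is the one classical fact about arcs
that dies in characteristic p, and BenitoPiltantReguera2022
locate the corpse precisely: X_∞ acquires SMALL components exactly at scheme points ζ where X is
arc-sharp, sharp ⇒ p | mult(ζ) and dim ζ ≥ 1
(closed points over perfect k are blunt), and bluntness is certified by ONE prime divisor over ζ
with separable residue field (Prop 4.3/Thm 4.4;
for the Cossart–Piltant dimension-4 specimen z^p + u₄u₁^p + u₃u₂^p the singular plane S = V(z,u₁,u₂)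
is sharp exactly for odd p, Ex. 6.3/6.4,
and Bl_S is regular — all three charts are graphs, checked by hand this session). The line uses this
POSITIVELY, as the only centre rule on the ledger that is intrinsic to X (no embedding, equation,
cleaning,
contact hypersurface or chosen valuation), non-trivial only in characteristic p, and that consumes
only LOWER-dimensional local resolution
(a sharp point is non-closed, so dim O_{X,ζ} ≤ dim X − 1; for 4-folds CossartPiltant2019): phase I
(SepExcModels) relocates every
positive-dimensional wild stratum — the habitat of Hironaka's quadric / the directrix failure
(barrier DirectrixSmallCharacteristic lives at
points whose residue field has p-rank ≥ 2, i.e. at generic points of strata of dimension ≥ 2) — into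
a canonical process; phase II (ResSepExc)
inherits a variety all of whose singular strata carry generically SMOOTH exceptional prime divisors
(BPR Prop 4.3), so restriction-to-E
inductions of Hironaka–CJS type can start stratum-generically, leaving closed points. Imported area:
arc spaces / differential algebra in
characteristic p (Kolchin, BPR, PiltantReguera2018, Chiu–de Fernex–Docampo arXiv:2206.08060) read
through valuation theory (prime divisors,
separably generated residue fields); none of the 20 open routes uses arc-space components or
separability of exceptional residue fields as
its lever (nearest: VerticalModels uses arc ORDERS of a base parameter on vertical fibres with Néron
dilatations; SectionAscent uses generic
sections; Descent's DescentPerfectToAll is shared verbatim). Negatives index empty.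

RANKED CRUXES. #2 SepExcModels (crux) — for every prime p, every perfect field k of characteristic p
and every integral separated k-scheme X of finite type there are an integral X' and a proper
birational π : X' → X such that X' is separably exceptional: every point ζ of X' is regular, or
closed, or has a finitely generated birational local model B = O_{X',ζ}[s] ⊆ K(X') with a prime 𝔮
over m_ζ, B_𝔮 regular, and B/𝔮 generically smooth over κ(ζ) (a prime divisor over ζ with separably
generated residue field; BPR Q6.6 / card K1, reached by the Kolchin phase). [difficulty:
open-problem] (why it might fail: Sharp strata nest and regenerate (BPR Ex 5.7:
(((y^p+z₁x₁^p)^p+z₂x₂^p)^p+…) has n+1 arc components with Y_{r−1} = Sing Y_r); blowing up a sharp S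
may create new sharp strata inside the inseparably fibred E; only the birational version for p > n!
is in print.) [BenitoPiltantReguera2022, PiltantReguera2018, CossartPiltant2019, Temkin2008,
arXiv:2206.08060]
#3 ResSepExc (crux) — for every prime p and every perfect field k of characteristic p, every
integral separated finite-type k-scheme that is separably exceptional (as in SepExcModels) has a
resolution (card K3: over a blunt stratum a generically smooth prime divisor exists, BPR Prop 4.3,
so the exceptional divisor of the right centre is generically a smooth family over the stratum and
restriction-type induction is available stratum-generically; closed points remain). [deps:
SepExcModels] [difficulty: open-problem] (why it might fail: Every variety with isolated
singularities is separably exceptional vacuously, so the class still contains all closed wild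
(kangaroo) points of z^(p^e)+F in A^5 (HauserPerlega2019); bluntness gives one separable prime
divisor per stratum, not a separable resolution of the transversal slice.)
[BenitoPiltantReguera2022, HauserPerlega2019, CossartJannsenSaito2020, Kollar2007, arXiv:1412.0868]
#4 DescentPerfectToAll (crux) — PerfectToAll (stmt-0549, shared verbatim with routes Descent /
WeightedInvariant / UniformComplexity / FrobeniusClosing …): for a prime p, resolution of all
reduced separated finite-type schemes over all PERFECT fields of characteristic p implies
ResolutionInChar p. [difficulty: open-problem] (why it might fail: Only known mechanism spreads X
over a f.g. field of definition and base-changes a resolution over a perfect subfield back; regular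
is not geometrically regular under inseparable extension (EGA IV 6.7.4), e.g. k = F_p((t))
(Temkin2008 Question 3.3.3 open).) [Temkin2008, Kollar2007,
Literature.Barriers.ResolutionOfSingularities.InseparableBaseChange,
Literature.Barriers.ResolutionOfSingularities.RegularNotGeometricallyRegular]
#9 Lossless (support) — the decomposition is two-sided: the summit implies both SepExcModels (a
resolution X' → X is a separably exceptional model — every point of X' is regular) and ResSepExc
(trivially); so X ⟺ the summit over perfect fields and neither crux is a strengthening. [difficulty:
provable-now] [BenitoPiltantReguera2022, Kollar2007]

TWO-LAYER PLAN. Foreseen glued splits (not filed now). SepExcModels ⇐ SharpFinite (the non-SepExc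
points of an integral finite-type Y over perfect k have finitely
many maximal elements under specialisation and their closures are the 'sharp strata'; BPR Prop 2.1 +
their Q6.2) → KolchinStep (one normalised
blow-up of the reduced union of maximal sharp strata strictly lowers a well-founded datum — the open
content; candidates: the number of arc
components over the stratum, the p-rank deficiency of the exceptional residue fields, dim of the
sharp locus) → SepExcModels. In dimension 4 a
first child SepExcModels4 may take CossartPiltant2019 (as the named fact) and Temkin2008 Prop 2.3.4
as inputs: X' regular over every non-closed
point of X, so all remaining sharp strata are VERTICAL over finitely many closed points. ResSepExc ⇐
StratumGeneric (over a blunt stratum the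
generically smooth prime divisor spreads a lower-dimensional resolution along an open of the
stratum) → ClosedPoints (the point-level wild
problem on SepExc varieties) → ResSepExc.

KILL CRITERIA. A variety over a perfect field with NO separably exceptional proper birational model
(¬SepExcModels) refutes the summit itself (Lossless) — it
would be a counterexample to resolution, so a refuter finding one files it against the Statement; a
sharp stratum that provably REGENERATES
isomorphically under every sharp-supported normalised blow-up (self-similar Kolchin tower on BPR's
Ex 5.7 family) kills the Kolchin-phase ENGINE
and forces a pivot of SepExcModels to non-canonical models (Temkin 2.3.4-style noetherian induction)
— close `refuted:SepExcModels` only if the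
statement itself falls. ResSepExc refuted ⇒ summit false. WeightedThesis / Pialt∧Picover /
LUrel∧PatchingRel proved elsewhere moot the route
(then SepExcModels and ResSepExc follow from Lossless).

NOT DECOMPOSED YET. The Kolchin-phase process itself (needs: the sharp locus as a reduced closed
subscheme, blow-up + normalisation as data — tree has
BlowupsExistence / normalization — and a termination datum, which is the open content); BPR's
Question 6.2 (valuative sharp = arc-sharp in
codimension ≥ 2) and Question 6.5 (curve selection), which would make sharpness decidable and give
Hasse–Wronskian certificates (card K2);
the arc-scheme definitions (D1 of the card) — deliberately avoided in the typed cruxes; the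
dimension-4 special case; any use of the
wild-cones / isolated-point results for the closed points left by phase II.

CHEAPEST FALSIFIER. Run the Kolchin phase on BPR's nested tower X₂ = V(((y^p + z₁x₁^p)^p + z₂x₂^p))
⊂ A^5 over F_p (dim 4; three arc components Y₀ ⊂ Y₁ ⊂ Y₂):
blow up the maximal sharp stratum with reduced structure, normalise, and decide sharpness of the new
strata (separability of the exceptional
residue fields = a p-basis / Jacobian-rank computation over F_p(stratum), one kit Gröbner job); if a
sharp stratum isomorphic to the original
reappears inside E, the canonical engine cycles and SepExcModels retreats to 'models exist but not
canonically'. Not run this cycle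
(operator A, literature-only). Lookups run: both cruxes are implied by the summit (regular X' is
SepExc by its first disjunct), so neither is
known-false; Q6.6 is printed open for p ≤ (dim X)! (BPR Prop 6.7 is birational only), so
SepExcModels is not a theorem; ResSepExc contains
every isolated hypersurface singularity in A^5, open.

NUMBERS. BPR Prop 6.7: birational Kolchin models for p > (dim X)!; Cor 4.5: sharp ⇒ p | mult(ζ); Cor
5.8/5.9: surfaces — complete list of small
components (codimension-one strata, radicial criterion); Ex 6.3/6.4: y^p + Σ_{i≤n} a_i x_i^p with
rank(∂a_j/∂θ_i) = n is sharp along its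
singular locus iff n ≤ p − 1. Known resolution: dim ≤ 3 all p (CossartPiltant2019), so every sharp
point of a 4-fold is locally resolvable.
Items at open: 5 (3 cruxes, 1 support, 1 assembly).

DEFINITION REQUESTS. None for the typed items (stalks, function field, Algebra.adjoin,
Localization.AtPrime/Away, Ideal.quotientMap, Algebra.Smooth are Mathlib).
Wanted later (card D1, not filed now): `Literature/AlgebraicGeometry/ArcSpaces`: arc scheme X_∞,
`ArcSharpAt`, `IsKolchin` — only needed to
state BPR Q6.2/Q6.5 and the Hasse–Wronskian certificates, not for this route's cruxes.

Novelty: Searches (2026-08-16): `lit frontier ResolutionOfSingularities --since 2021` (60 rows; arc items: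
none on small components); `lit search --source zbmath` ×6 ("resolution singularities positive
characteristic" 30 rows → Teissier 2311.12456, Bérczi 2602.06553, Cutkosky 2111.12818, HP PRIMS
2024, BPR 2022, Posva … all read; "arc space positive characteristic irreducible components Kolchin"
1: CLNS; "small irreducible components arc spaces" 2: BPR, CLNS; "separably generated residue field
exceptional divisor positive characteristic resolution" 0; "generically smooth exceptional divisor
imperfect residue field blowing up" 0); `lit search --source arxiv "arc space positive
characteristic Kolchin irreducible"` 0; `lit search --source crossref "Benito Piltant Reguera arc"`
(8: BPR, PiltantReguera2018, CPR valuations); `lit citing doi:10.1016/j.jpaa.2022.107110` (3: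
arXiv:2206.08060 read — arc fibres, not Q6.6; Adv. Math. 2023 leaps; OWR 2019); `lit galaxy search
"resolution of singularities in positive characteristic" --star all` (12 rows, KM IFP, nothing on
arcs); lit read of arXiv:2311.12456, 2602.06553, 2111.12818, 2205.05438, 2405.05735, 0804.1554,
1906.06745, doi:10.4171/prims/60-4-5, BPR (held) §§1,4,6; the 20 route files; 95 open + 91 closed
idea cards (titles/grades; full read of blunt-or-sharp-kolchin-models, wild-cones-cannot-hide,
tropical-schoen-certificates, schoen-reembedding, cjs/ifp/f-signature/alpha-p closures).
Nearest prior art found: BenitoPiltantReguera2022 (doi:  [refs: 10.1016/j.jpaa.2022.107110`, 10.4171/prims/60-4-5, 10.1016/j.jpaa.2022.107110, 2206.08060, 2311.12456, doi:10.1016/j.jpaa.2022.107110, doi:10.4171/prims/60-4-5, PiltantReguera2018, BenitoPiltantReguera2022]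

Barriers (technique_class: arc-components kolchin-phase separable-divisors): - technique_class: arc-components kolchin-phase separable-divisors
- Literature.Barriers.ResolutionOfSingularities.DirectrixSmallCharacteristicNarrow: this is the
line's habitat, not an obstruction — Hironaka's quadric needs a 2-independent pair (λ, μ) in the
residue field, i.e. a non-closed point of a stratum of dimension ≥ 2; such strata are what phase I
blows up as wholes (sharp ⇒ positive-dimensional, p | mult) instead of following near points inside
them; whether the quadric cone over F₂(λ,μ) is sharp is a p-basis computation listed under Cheapest
falsifier's pipeline; the bet is that wound/directrix-failure points are sharp.
- Literature.Barriers.ResolutionOfSingularities.Narasimhan1983_noSmoothHypersurfaceThroughTopLocus: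
evaded — centres are closures of scheme points read off separability of exceptional residue fields,
never required to lie in a smooth hypersurface; Narasimhan's threefold has its top locus a curve
through a closed point and is handled (or not) in phase II honestly.
- Literature.Barriers.ResolutionOfSingularities.Hauser2003_kangarooShadeIncrease: it does not evade
it; kangaroo/antelope points are CLOSED points (blunt over perfect k), so ResSepExc inherits them in
full — the bet is only that phase I removes the positive-dimensional wild strata first, where
Hauser–Perlega themselves note larger centres exist.
- Literature.Barriers.ResolutionOfSingularities.hauserPerlega_mohProofBoundFails: same — no residual
order is tracked; HP's unbounded runs are poin

History (route lifecycle, newest last):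
- 2026-08-25T06:26:46Z · DORMANT — reconciler: no traction for 7.5 d (last activity item-evidence-added at 2026-08-17T19:03:53Z); parked, not closed — `ledger route dormant route-ResolutionOfSing (operator:999:1429163)
- 2026-08-26T17:02:35Z · REACTIVATED — reconciler: reactivated — activity statement-claimed at 2026-08-26T16:25:04Z after parking at 2026-08-25T06:26:46Z (operator:999:3643408)

sub-problem: ResolutionOfSingularities · status: open · opened planner-plan-novel-ResolutionOfSingularities-Re-dc19aa3a-a-v2-g10-0 2026-08-16T21:10:31Z · rev 1 · ledger route-ResolutionOfSingularities-SharpStrata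
GENERATED by the gate from the ledger (D-0016/17). Provers cite these decls: `theorem foo : Summit.ResolutionOfSingularities.ResolutionOfSingularities.Theses.SharpStrata.<Decl> := …` in Summits/ResolutionOfSingularities/ResolutionOfSingularities/Theorems/<Name>.lean.
-/

namespace Summit.ResolutionOfSingularities.ResolutionOfSingularities.Theses.SharpStrata

open scoped BigOperators Topology Manifold Classical MeasureTheory ProbabilityTheory Matrix InnerProductSpace ComplexConjugate ContinuousMap
open Filter Set Function TopologicalSpace MeasureTheory

attribute [summit_statement] _root_.ResolutionOfSingularities

/-- item stmt-ResolutionOfSingularities-16828 · crux · rank 2 · open · by planner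
why it might fail: Sharp strata nest and regenerate (BPR Ex 5.7: (((y^p+z₁x₁^p)^p+z₂x₂^p)^p+…) has n+1 arc components with Y_{r−1} = Sing Y_r); blowing up a sharp S may create new sharp strata inside the inseparably fibred E; only the birational version for p > n! is in print.
sources: BenitoPiltantReguera2022, PiltantReguera2018, CossartPiltant2019, Temkin2008, arXiv:2206.08060
[crux] for every prime p, every perfect field k of characteristic p and every integral separated
k-scheme X of finite type there are an integral X' and a proper birational π : X' → X such that X'
is separably exceptional: every point ζ of X' is regular, or closed, or has a finitely generated
birational local model B = O_{X',ζ}[s] ⊆ K(X') with a prime 𝔮 over m_ζ, B_𝔮 regular, and B/𝔮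
generically smooth over κ(ζ) (a prime divisor over ζ with separably generated residue field; BPR
Q6.6 / card K1, reached by the Kolchin phase). [difficulty: open-problem] -/
@[route_item "route-ResolutionOfSingularities-SharpStrata", crux]
def SepExcModels : Prop :=
  let SepExc : ∀ (Y : AlgebraicGeometry.Scheme.{0}) [AlgebraicGeometry.IsIntegral Y], Prop := fun Y _ => ∀ ζ : Y, IsRegularLocalRing (Y.presheaf.stalk ζ) ∨ IsClosed ({ζ} : Set Y) ∨ ∃ (s : Finset Y.functionField) (𝔮 : Ideal (Algebra.adjoin (Y.presheaf.stalk ζ) (s : Set Y.functionField))) (_ : 𝔮.IsPrime) (hle : IsLocalRing.maximalIdeal (Y.presheaf.stalk ζ) ≤ 𝔮.comap (algebraMap (Y.presheaf.stalk ζ) (Algebra.adjoin (Y.presheaf.stalk ζ) (s : Set Y.functionField)))), IsRegularLocalRing (Localization.AtPrime 𝔮) ∧ ∃ g : Algebra.adjoin (Y.presheaf.stalk ζ) (s : Set Y.functionField), g ∉ 𝔮 ∧ (letI := ((algebraMap _ (Localization.Away (Ideal.Quotient.mk 𝔮 g))).comp (Ideal.quotientMap 𝔮 (algebraMap (Y.presheaf.stalk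 ζ) (Algebra.adjoin (Y.presheaf.stalk ζ) (s : Set Y.functionField))) hle)).toAlgebra; Algebra.Smooth (Y.presheaf.stalk ζ ⧸ IsLocalRing.maximalIdeal (Y.presheaf.stalk ζ)) (Localization.Away (Ideal.Quotient.mk 𝔮 g))); ∀ p : ℕ, p.Prime → ∀ (k : Type) [Field k] [CharP k p] [PerfectField k] (X : AlgebraicGeometry.Scheme.{0}) [AlgebraicGeometry.IsIntegral X] (f : X ⟶ AlgebraicGeometry.Spec (.of k)), AlgebraicGeometry.IsSeparated f → AlgebraicGeometry.LocallyOfFiniteType f → AlgebraicGeometry.QuasiCompact f → ∃ (X' : AlgebraicGeometry.Scheme.{0}) (_ : AlgebraicGeometry.IsIntegral X') (π : X' ⟶ X), AlgebraicGeometry.IsProper π ∧ Literature.AlgebraicGeometry.Resolution.IsBirational π ∧ SepExc X'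

/-- item stmt-ResolutionOfSingularities-16829 · crux · rank 3 · open · by planner
why it might fail: Every variety with isolated singularities is separably exceptional vacuously, so the class still contains all closed wild (kangaroo) points of z^(p^e)+F in A^5 (HauserPerlega2019); bluntness gives one separable prime divisor per stratum, not a separable resolution of the transversal slice.
sources: BenitoPiltantReguera2022, HauserPerlega2019, CossartJannsenSaito2020, Kollar2007, arXiv:1412.0868
[crux] for every prime p and every perfect field k of characteristic p, every integral separated
finite-type k-scheme that is separably exceptional (as in SepExcModels) has a resolution (card K3:
over a blunt stratum a generically smooth prime divisor exists, BPR Prop 4.3, so the exceptional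
divisor of the right centre is generically a smooth family over the stratum and restriction-type
induction is available stratum-generically; closed points remain). [deps: SepExcModels] [difficulty:
open-problem] -/
@[route_item "route-ResolutionOfSingularities-SharpStrata", crux]
def ResSepExc : Prop :=
  let SepExc : ∀ (Y : AlgebraicGeometry.Scheme.{0}) [AlgebraicGeometry.IsIntegral Y], Prop := fun Y _ => ∀ ζ : Y, IsRegularLocalRing (Y.presheaf.stalk ζ) ∨ IsClosed ({ζ} : Set Y) ∨ ∃ (s : Finset Y.functionField) (𝔮 : Ideal (Algebra.adjoin (Y.presheaf.stalk ζ) (s : Set Y.functionField))) (_ : 𝔮.IsPrime) (hle : IsLocalRing.maximalIdeal (Y.presheaf.stalk ζ) ≤ 𝔮.comap (algebraMap (Y.presheaf.stalk ζ) (Algebra.adjoin (Y.presheaf.stalk ζ) (s : Set Y.functionField)))), IsRegularLocalRing (Localization.AtPrime 𝔮) ∧ ∃ g : Algebra.adjoin (Y.presheaf.stalk ζ) (s : Set Y.functionField), g ∉ 𝔮 ∧ (letI := ((algebraMap _ (Localization.Away (Ideal.Quotient.mk 𝔮 g))).comp (Ideal.quotientMap 𝔮 (algebraMap (Y.presheaf.stalk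 ζ) (Algebra.adjoin (Y.presheaf.stalk ζ) (s : Set Y.functionField))) hle)).toAlgebra; Algebra.Smooth (Y.presheaf.stalk ζ ⧸ IsLocalRing.maximalIdeal (Y.presheaf.stalk ζ)) (Localization.Away (Ideal.Quotient.mk 𝔮 g))); ∀ p : ℕ, p.Prime → ∀ (k : Type) [Field k] [CharP k p] [PerfectField k] (X : AlgebraicGeometry.Scheme.{0}) [AlgebraicGeometry.IsIntegral X] (f : X ⟶ AlgebraicGeometry.Spec (.of k)), AlgebraicGeometry.IsSeparated f → AlgebraicGeometry.LocallyOfFiniteType f → AlgebraicGeometry.QuasiCompact f → SepExc X → Literature.AlgebraicGeometry.Resolution.Scheme.HasResolution X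

/-- item stmt-ResolutionOfSingularities-0549 · crux · rank 4 · open · by planner
why it might fail: Only known mechanism spreads X over a f.g. field of definition and base-changes a resolution over a perfect subfield back; regular is not geometrically regular under inseparable extension (EGA IV 6.7.4), e.g. k = F_p((t)) (Temkin2008 Question 3.3.3 open).
sources: Temkin2008, Kollar2007, Literature.Barriers.ResolutionOfSingularities.InseparableBaseChange, Literature.Barriers.ResolutionOfSingularities.RegularNotGeometricallyRegular
PerfectToAll: for a prime p, resolution of all reduced separated finite-type schemes over all
PERFECT fields of char p implies ResolutionInChar p (all fields of char p). Expected inputs: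
Neron-Popescu (Stacks 07GC), spreading out, openness of regular locus on excellent schemes;
regularity is not stable under inseparable ground field extension, which is the difficulty. -/
@[route_item "route-ResolutionOfSingularities-SharpStrata", crux]
def DescentPerfectToAll : Prop :=
  ∀ p : ℕ, p.Prime → (∀ (k : Type) [Field k] [CharP k p] [PerfectField k] (X : AlgebraicGeometry.Scheme.{0}) (f : X ⟶ AlgebraicGeometry.Spec (.of k)), AlgebraicGeometry.IsSeparated f → AlgebraicGeometry.LocallyOfFiniteType f → AlgebraicGeometry.QuasiCompact f → AlgebraicGeometry.IsReduced X → Literature.AlgebraicGeometry.Resolution.Scheme.HasResolution X) → Literature.AlgebraicGeometry.Resolution.ResolutionInChar.{0} p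

/-- item stmt-ResolutionOfSingularities-16830 · support · rank 9 · open · by planner
sources: BenitoPiltantReguera2022, Kollar2007
[support] the decomposition is two-sided: the summit implies both SepExcModels (a resolution X' → X
is a separably exceptional model — every point of X' is regular) and ResSepExc (trivially); so X ⟺
the summit over perfect fields and neither crux is a strengthening. [difficulty: provable-now] -/
@[route_item "route-ResolutionOfSingularities-SharpStrata"]
def Lossless : Prop :=
  _root_.ResolutionOfSingularities → SepExcModels ∧ ResSepExc

/-- item stmt-ResolutionOfSingularities-16831 · assembly · rank 1 · open · by planner
sources: BenitoPiltantReguera2022, CossartPiltant2019, Kollar2007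
[assembly] ResSepExc → SepExcModels → DescentPerfectToAll → ResolutionOfSingularities. -/
@[route_item "route-ResolutionOfSingularities-SharpStrata"]
def Assembly : Prop :=
  ResSepExc → SepExcModels → DescentPerfectToAll → _root_.ResolutionOfSingularities

/-! D-0027 §2.1 — DECIDING THEOREM (planner-authored via `route open/edit --closes-file`; by planner-plan-novel-ResolutionOfSingularities-Re-dc19aa3a-a-v 2026-08-16T21:10:31Z):
its hypotheses are this route's items and its conclusion the sub-problem Statement (glue_lint), and it elaborates with this file. -/

/-- Deciding theorem: reduce to integral closed subschemes over a perfect field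
(`hasResolution_of_forall_closeds`), take a separably-exceptional model (`SepExcModels`),
resolve it (`ResSepExc`), transport along the proper birational map
(`Scheme.HasResolution.of_isBirational`), and pass to all fields (`DescentPerfectToAll`). -/
@[closes "route-ResolutionOfSingularities-SharpStrata"] theorem closes (hR : ResSepExc) (hM : SepExcModels) (hD : DescentPerfectToAll) :
    _root_.ResolutionOfSingularities := by
  refine (_root_.ResolutionOfSingularities_iff).mpr fun p hp => hD p hp ?_
  intro k _ _ _ X f hs hl hq hr
  haveI := hs; haveI := hl; haveI := hq; haveI := hr
  refine Literature.AlgebraicGeometry.Resolution.ComponentGluing.hasResolution_of_forall_closeds X f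
    fun Z hZ => ?_
  haveI := hZ
  obtain ⟨X', hX', π, hπ, hb, hsep⟩ := hM p hp k _
    (CategoryTheory.CategoryStruct.comp
      (AlgebraicGeometry.Scheme.IdealSheafData.vanishingIdeal Z).subschemeι f) inferInstance inferInstance
    inferInstance
  haveI := hX'; haveI := hπ
  refine Literature.AlgebraicGeometry.Resolution.ComponentGluing.Scheme.HasResolution.of_isBirational
    π hb ?_
  exact hR p hp k X' (CategoryTheory.CategoryStruct.comp π (CategoryTheory.CategoryStruct.comp
      (AlgebraicGeometry.Scheme.IdealSheafData.vanishingIdeal Z).subschemeι f))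
    inferInstance inferInstance inferInstance hsep

end Summit.ResolutionOfSingularities.ResolutionOfSingularities.Theses.SharpStrata
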